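import Literature.AlgebraicGeometry.Resolution.RegularLocalRingsQuotient
import Mathlib.RingTheory.RegularLocalRing.Defs
import HarnessLib

/-!
# [OURS · L1 W4.5(b) · EL♮] Ring brick B2 «Adm dictionary»: the embedding dimension of a quotient of a
# local ring drops iff the ideal is not inside `𝔪²` (crux `EquisingularLiftNat` =
# stmt-ResolutionOfSingularities-20038)

HONEST FRAMING. OURS (cell res-hironaka, crux chain w45b, slot W4.5(b)); NOT a statement of any manuscript;
AI-written, weaker than expert review. Helper `--supports stmt-ResolutionOfSingularities-20038 --as helper`; it
closes nothing. Object = ring brick **B2** offered to res-D-pv-003 / res-D-pv-013 (STATUS 2026-08-27T07:43:49Z) for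
the T-TAIL / T-Δ-ISO adapter `hMS`: res-D-pv-013 (STATUS 07:37:46Z) proposes the INTRINSIC admissibility predicate
`Adm Γ z :⟺ finrank_{κ(z)} (𝔪_{Γ,z}/𝔪_{Γ,z}²) ≤ d` and states (i) that it is invariant under isomorphisms of the stalk
and (ii) that it is equivalent to res-D-pv-003's `∃ u ∈ (I_T)_{ι z}, u ∉ 𝔪²` whenever `𝒪_{X',ι z}` is a regular local
ring of dimension `d + 1` and `𝒪_{Γ,z} ≅ 𝒪_{X',ι z} ⧸ (I_T)_{ι z}`. This file is the ring-level content of (i) and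
(ii). Pure commutative algebra; no scheme appears in this file. Sibling of B1
(`…Theorems/EquisingularLiftEquisingularLiftNatQuotientDVRAvoiding.lean`).

CONTENT.
* `finrank_cotangentSpace_eq_of_ringEquiv` — (i): for local rings `A ≃+* B` with `A` Noetherian, the cotangent
  spaces `𝔪_A/𝔪_A²` and `𝔪_B/𝔪_B²` have the same dimension over the respective residue fields.
* `exists_mem_not_mem_sq_iff_spanFinrank_lt` — for a Noetherian local ring `(R, 𝔪)` and an ideal `I` with `R ⧸ I`
  local (so `I ≤ 𝔪`): `(∃ u ∈ I, u ∉ 𝔪²) ↔ μ(𝔪_{R⧸I}) < μ(𝔪_R)` (`μ` = minimal number of generators =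
  `Submodule.spanFinrank`); the two halves `spanFinrank_maximalIdeal_quotient_lt_of_not_mem_sq` and
  `spanFinrank_maximalIdeal_le_quotient_of_le_sq` are stated separately; cotangent form
  `exists_mem_not_mem_sq_iff_finrank_cotangentSpace_lt`; and res-D-pv-003's (L-ADM) shape (STATUS 07:41:35Z)
  `exists_not_mem_sq_of_finrank_cotangentSpace_le` (+ `_of_ringEquiv` read on a local ring `A ≃+* R ⧸ I`):
  `finrank Cot(R ⧸ I) ≤ d` and `d + 1 ≤ finrank Cot(R)` ⇒ `∃ u ∈ I, u ∉ 𝔪²` — NO regularity needed.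
* `finrank_cotangentSpace_quotient_le_iff` — (ii): for a REGULAR local ring `R` with `dim R = d + 1` and `I ≤ 𝔪`:
  `finrank (𝔪_{R⧸I}/𝔪_{R⧸I}²) ≤ d ↔ ∃ u ∈ I, u ∉ 𝔪²`; and `finrank_cotangentSpace_le_iff_of_ringEquiv_quotient` —
  the same read on any local ring `A ≃+* R ⧸ I` (the stalk `𝒪_{Γ,z}`).

PROOF (folklore; Matsumura, *Commutative Ring Theory*, §14, p. 104–106: «the smallest number of elements needed to
generate `𝔪` is `rank_k 𝔪/𝔪²`», Thm. 14.2 and the Remark after it). If `u ∈ I ∖ 𝔪²` then `R ⧸ I` is a quotient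
of `R ⧸ (u)` and `μ(𝔪_{R⧸(u)}) + 1 = μ(𝔪_R)` (tree `spanFinrank_maximalIdeal_quotient_add_one`, no regularity
needed), while `μ` does not increase under surjections (Mathlib `Ideal.spanFinrank_map_le_of_fg`). Conversely, if
`I ≤ 𝔪²`, lift a minimal system of generators of `𝔪_{R⧸I}` to `R`: it generates `𝔪` modulo `I ≤ 𝔪²`, hence
generates `𝔪` by Nakayama (Mathlib `Submodule.le_of_le_smul_of_le_jacobson_bot`), so `μ(𝔪_R) ≤ μ(𝔪_{R⧸I})`
(argument as in the tree's `Summits/Ventures/HSemireg/PorteousShapesRegularity.lean`,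
`spanFinrank_maximalIdeal_le_quotient_of_le_sq`, re-proved here to keep the imports leaf-only). For a regular local
ring `μ(𝔪_R) = dim R` (Mathlib `IsRegularLocalRing.spanFinrank_maximalIdeal`) and
`μ = finrank (𝔪/𝔪²)` (Mathlib `IsLocalRing.spanFinrank_maximalIdeal_eq_finrank_cotangentSpace`); invariance under
`≃+*` is Mathlib's `Ideal.spanFinrank_map_eq_of_ringEquiv` + `IsLocalRing.map_ringEquiv_maximalIdeal`.
Mathlib searched (pin): `IsLocalRing.spanFinrank_maximalIdeal_eq_finrank_cotangentSpace`,
`Ideal.spanFinrank_map_le_of_fg`, `Ideal.spanFinrank_map_eq_of_ringEquiv`, `IsLocalRing.map_ringEquiv_maximalIdeal`,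
`IsLocalRing.map_maximalIdeal_of_surjective`, `Submodule.FG.exists_span_finset_card_eq_spanFinrank`,
`Submodule.le_of_le_smul_of_le_jacobson_bot`, `IsRegularLocalRing.spanFinrank_maximalIdeal`; tree:
`spanFinrank_maximalIdeal_quotient_add_one`, `isLocalRing_quotient`, `maximalIdeal_quotient_eq_map`.

References: H. Matsumura, *Commutative Ring Theory*, Cambridge Studies in Advanced Mathematics 8 (1986), §14,
Thm. 14.2 [Matsumura1987] — through Mathlib and the cited tree file.
-/

set_option linter.dupNamespace false -- mandated namespace `Summit.<Summit>.<Problem>` of this single-conjunct summit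

universe u v

open IsLocalRing

namespace Summit.ResolutionOfSingularities.ResolutionOfSingularities.Cruxes.EquisingularLiftNat.Sections

open Literature.AlgebraicGeometry.Resolution

/-! ## (i) Invariance of the embedding dimension under ring isomorphisms -/

/-- **The embedding dimension is an isomorphism invariant.** For local rings `A ≃+* B` with `A` Noetherian, the
cotangent spaces `𝔪_A/𝔪_A²` and `𝔪_B/𝔪_B²` have the same (finite) dimension over the residue fields. Ring core of
res-D-pv-013's `hAdm` («stalk iso ⇒ cotangent iso»). [folklore] -/
theorem finrank_cotangentSpace_eq_of_ringEquiv {A : Type u} {B : Type v} [CommRing A] [CommRing B]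
    [IsLocalRing A] [IsNoetherianRing A] [IsLocalRing B] (e : A ≃+* B) :
    Module.finrank (ResidueField A) (CotangentSpace A) =
      Module.finrank (ResidueField B) (CotangentSpace B) := by
  haveI : IsNoetherianRing B := isNoetherianRing_of_ringEquiv A e
  rw [← spanFinrank_maximalIdeal_eq_finrank_cotangentSpace,
    ← spanFinrank_maximalIdeal_eq_finrank_cotangentSpace, ← map_ringEquiv_maximalIdeal e,
    Ideal.spanFinrank_map_eq_of_ringEquiv]

/-! ## The minimal number of generators of the maximal ideal of a quotient -/

section Quotient

variable {R : Type u} [CommRing R] [IsLocalRing R] [IsNoetherianRing R]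

omit [IsNoetherianRing R] in
/-- If `R ⧸ I` is a local ring (in particular non-trivial) then `I` is a proper ideal, hence `I ≤ 𝔪`.
[folklore] -/
theorem le_maximalIdeal_of_isLocalRing_quotient (I : Ideal R) [IsLocalRing (R ⧸ I)] :
    I ≤ maximalIdeal R :=
  IsLocalRing.le_maximalIdeal (Ideal.Quotient.nontrivial_iff.mp inferInstance)

/-- `μ` does not increase in a quotient: `μ(𝔪_{R⧸I}) ≤ μ(𝔪_R)` for every ideal `I` with `R ⧸ I` local.
[folklore] -/
theorem spanFinrank_maximalIdeal_quotient_le (I : Ideal R) [IsLocalRing (R ⧸ I)] :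
    (maximalIdeal (R ⧸ I)).spanFinrank ≤ (maximalIdeal R).spanFinrank := by
  rw [← map_maximalIdeal_of_surjective (Ideal.Quotient.mk I) Ideal.Quotient.mk_surjective]
  exact Ideal.spanFinrank_map_le_of_fg _ (maximalIdeal R).fg_of_isNoetherianRing

/-- **An element of `I ∖ 𝔪²` makes the embedding dimension drop**: if `u ∈ I`, `u ∉ 𝔪²` (and `R ⧸ I` is
local), then `μ(𝔪_{R⧸I}) < μ(𝔪_R)` — indeed `R ⧸ I` is a quotient of `R ⧸ (u)` and
`μ(𝔪_{R⧸(u)}) + 1 = μ(𝔪_R)`. No regularity is needed. [cite: Matsumura1987, Thm. 14.2] (Remark after the proof: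
«(3) ⇒ (1) does not need regularity».) -/
theorem spanFinrank_maximalIdeal_quotient_lt_of_not_mem_sq {I : Ideal R} [IsLocalRing (R ⧸ I)] {u : R}
    (huI : u ∈ I) (hu2 : u ∉ maximalIdeal R ^ 2) :
    (maximalIdeal (R ⧸ I)).spanFinrank < (maximalIdeal R).spanFinrank := by
  have hu : u ∈ maximalIdeal R := le_maximalIdeal_of_isLocalRing_quotient I huI
  haveI : IsLocalRing (R ⧸ Ideal.span {u}) := isLocalRing_quotient (Ideal.span_singleton_ne_top hu)
  -- `R ⧸ I` is a quotient of `R ⧸ (u)`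
  have hle : Ideal.span {u} ≤ I := (Ideal.span_singleton_le_iff_mem _).mpr huI
  have hsurj : Function.Surjective (Ideal.Quotient.factor hle) := Ideal.Quotient.factor_surjective hle
  haveI : IsNoetherianRing (R ⧸ Ideal.span {u}) := inferInstance
  have h1 : (maximalIdeal (R ⧸ I)).spanFinrank ≤ (maximalIdeal (R ⧸ Ideal.span {u})).spanFinrank := by
    rw [← map_maximalIdeal_of_surjective _ hsurj]
    exact Ideal.spanFinrank_map_le_of_fg _ (maximalIdeal _).fg_of_isNoetherianRing
  have h2 := spanFinrank_maximalIdeal_quotient_add_one hu hu2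
  omega

/-- **An ideal inside `𝔪²` does not lower the embedding dimension**: if `I ≤ 𝔪²` then
`μ(𝔪_R) ≤ μ(𝔪_{R⧸I})` (lift a minimal system of generators of `𝔪_{R⧸I}`; it generates `𝔪` modulo `I ≤ 𝔪·𝔪`,
hence generates `𝔪` by Nakayama). [folklore] (Same argument as the tree's
`Summits/Ventures/HSemireg/PorteousShapesRegularity.lean`, re-proved to keep imports leaf-only.) -/
theorem spanFinrank_maximalIdeal_le_quotient_of_le_sq {I : Ideal R} (hI : I ≤ maximalIdeal R ^ 2)
    [IsLocalRing (R ⧸ I)] :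
    (maximalIdeal R).spanFinrank ≤ (maximalIdeal (R ⧸ I)).spanFinrank := by
  classical
  have fg : (maximalIdeal (R ⧸ I)).FG := (maximalIdeal (R ⧸ I)).fg_of_isNoetherianRing
  obtain ⟨s, hscard, hsspan⟩ := Submodule.FG.exists_span_finset_card_eq_spanFinrank fg
  -- lift the generators to `R`
  let g : R ⧸ I → R := Function.surjInv (Ideal.Quotient.mk_surjective (I := I))
  have hg : ∀ w, Ideal.Quotient.mk I (g w) = w := Function.surjInv_eq Ideal.Quotient.mk_surjective
  let s' : Finset R := s.image g
  have himage : (Ideal.Quotient.mk I) '' (s' : Set R) = (s : Set (R ⧸ I)) := by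
    simp only [s', Finset.coe_image, ← Set.image_comp]
    have : (Ideal.Quotient.mk I) ∘ g = id := funext hg
    rw [this, Set.image_id]
  have hmap : (Ideal.span (s' : Set R)).map (Ideal.Quotient.mk I) = maximalIdeal (R ⧸ I) := by
    rw [Ideal.map_span, himage]
    exact hsspan
  have hcomap : (maximalIdeal (R ⧸ I)).comap (Ideal.Quotient.mk I) = maximalIdeal R := by
    rw [← map_maximalIdeal_of_surjective (Ideal.Quotient.mk I) Ideal.Quotient.mk_surjective,
      Ideal.comap_map_of_surjective _ Ideal.Quotient.mk_surjective, ← RingHom.ker_eq_comap_bot,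
      Ideal.mk_ker, sup_eq_left]
    exact hI.trans (Ideal.pow_le_self two_ne_zero)
  -- `𝔪 ≤ span s' ⊔ I ≤ span s' ⊔ 𝔪 • 𝔪`
  have hle : maximalIdeal R ≤ Ideal.span (s' : Set R) ⊔ maximalIdeal R • maximalIdeal R := by
    have h1 : maximalIdeal R ≤ Ideal.span (s' : Set R) ⊔ I := by
      rw [← hcomap, ← hmap, Ideal.comap_map_of_surjective _ Ideal.Quotient.mk_surjective,
        ← RingHom.ker_eq_comap_bot, Ideal.mk_ker]
    refine h1.trans (sup_le_sup_left ?_ _)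
    rw [Ideal.smul_eq_mul, ← pow_two]
    exact hI
  -- Nakayama: `𝔪 ≤ span s'`
  have hNak : maximalIdeal R ≤ Ideal.span (s' : Set R) :=
    Submodule.le_of_le_smul_of_le_jacobson_bot (maximalIdeal R).fg_of_isNoetherianRing
      (maximalIdeal_le_jacobson ⊥) hle
  -- and `span s' ≤ 𝔪` because the lifts lie in `𝔪`
  have hge : Ideal.span (s' : Set R) ≤ maximalIdeal R := by
    rw [Ideal.span_le]
    intro x hx
    have hx' : Ideal.Quotient.mk I x ∈ maximalIdeal (R ⧸ I) := by
      rw [← hsspan]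
      refine Ideal.subset_span ?_
      rw [← himage]
      exact Set.mem_image_of_mem _ hx
    have := Ideal.mem_comap.mpr hx'
    rwa [hcomap] at this
  have heq : maximalIdeal R = Ideal.span (s' : Set R) := le_antisymm hNak hge
  calc (maximalIdeal R).spanFinrank = (Ideal.span (s' : Set R)).spanFinrank := by rw [← heq]
    _ ≤ (s' : Set R).ncard := Submodule.spanFinrank_span_le_ncard_of_finite s'.finite_toSet
    _ = s'.card := Set.ncard_coe_finset s'
    _ ≤ s.card := Finset.card_image_le
    _ = (maximalIdeal (R ⧸ I)).spanFinrank := hscard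

/-- **The embedding dimension of `R ⧸ I` drops iff `I ⊄ 𝔪²`.** For a Noetherian local ring `(R, 𝔪)` and an ideal
`I` with `R ⧸ I` local: `(∃ u ∈ I, u ∉ 𝔪²) ↔ μ(𝔪_{R⧸I}) < μ(𝔪_R)`. [folklore] [cite: Matsumura1987, §14] -/
theorem exists_mem_not_mem_sq_iff_spanFinrank_lt (I : Ideal R) [IsLocalRing (R ⧸ I)] :
    (∃ u ∈ I, u ∉ maximalIdeal R ^ 2) ↔
      (maximalIdeal (R ⧸ I)).spanFinrank < (maximalIdeal R).spanFinrank := by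
  constructor
  · rintro ⟨u, huI, hu2⟩
    exact spanFinrank_maximalIdeal_quotient_lt_of_not_mem_sq huI hu2
  · intro hlt
    by_contra h
    have hI2 : I ≤ maximalIdeal R ^ 2 := fun u hu => by_contra fun hu2 => h ⟨u, hu, hu2⟩
    exact absurd hlt (Nat.not_lt.mpr (spanFinrank_maximalIdeal_le_quotient_of_le_sq (I := I) hI2))

/-- Cotangent-space form of `exists_mem_not_mem_sq_iff_spanFinrank_lt`: for a Noetherian local ring `(R, 𝔪)` and
`I` with `R ⧸ I` local, `(∃ u ∈ I, u ∉ 𝔪²) ↔ finrank (𝔪_{R⧸I}/𝔪_{R⧸I}²) < finrank (𝔪_R/𝔪_R²)`. [folklore] -/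
theorem exists_mem_not_mem_sq_iff_finrank_cotangentSpace_lt (I : Ideal R) [IsLocalRing (R ⧸ I)] :
    (∃ u ∈ I, u ∉ maximalIdeal R ^ 2) ↔
      Module.finrank (ResidueField (R ⧸ I)) (CotangentSpace (R ⧸ I)) <
        Module.finrank (ResidueField R) (CotangentSpace R) := by
  rw [← spanFinrank_maximalIdeal_eq_finrank_cotangentSpace,
    ← spanFinrank_maximalIdeal_eq_finrank_cotangentSpace]
  exact exists_mem_not_mem_sq_iff_spanFinrank_lt I

/-- **res-D-pv-003's (L-ADM), ring form, no regularity needed.** For a Noetherian local ring `(R, 𝔪)`, an ideal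
`I` with `R ⧸ I` local and `d : ℕ`: if `finrank (𝔪_{R⧸I}/𝔪_{R⧸I}²) ≤ d` («Adm» of the quotient) while
`d + 1 ≤ finrank (𝔪_R/𝔪_R²)` (the stage fact, e.g. `R` regular of dimension `d + 1`), then `I` contains an element
outside `𝔪²`. [folklore] -/
theorem exists_not_mem_sq_of_finrank_cotangentSpace_le (I : Ideal R) [IsLocalRing (R ⧸ I)] {d : ℕ}
    (hΓ : Module.finrank (ResidueField (R ⧸ I)) (CotangentSpace (R ⧸ I)) ≤ d)
    (hX : d + 1 ≤ Module.finrank (ResidueField R) (CotangentSpace R)) :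
    ∃ u ∈ I, u ∉ maximalIdeal R ^ 2 :=
  (exists_mem_not_mem_sq_iff_finrank_cotangentSpace_lt I).mpr (by omega)

/-- **(L-ADM) read on the stalk**: the same with the quotient replaced by any local ring `A ≃+* R ⧸ I` (e.g.
`A = 𝒪_{Γ,z}`, `R = 𝒪_{X',ι z}`, `I = (I_T)_{ι z}`); `R ⧸ I` is then local automatically. [folklore] -/
theorem exists_not_mem_sq_of_finrank_cotangentSpace_le_of_ringEquiv (I : Ideal R)
    {A : Type v} [CommRing A] [IsLocalRing A] (e : A ≃+* R ⧸ I) {d : ℕ}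
    (hΓ : Module.finrank (ResidueField A) (CotangentSpace A) ≤ d)
    (hX : d + 1 ≤ Module.finrank (ResidueField R) (CotangentSpace R)) :
    ∃ u ∈ I, u ∉ maximalIdeal R ^ 2 := by
  haveI : IsLocalRing (R ⧸ I) := e.isLocalRing
  haveI : IsNoetherianRing A := isNoetherianRing_of_ringEquiv (R ⧸ I) e.symm
  rw [finrank_cotangentSpace_eq_of_ringEquiv e] at hΓ
  exact exists_not_mem_sq_of_finrank_cotangentSpace_le I hΓ hX

/-- Converse bookkeeping: an element of `I ∖ 𝔪²` forces `finrank (𝔪_A/𝔪_A²) + 1 ≤ finrank (𝔪_R/𝔪_R²)` for any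
local ring `A ≃+* R ⧸ I`. [folklore] -/
theorem finrank_cotangentSpace_add_one_le_of_not_mem_sq (I : Ideal R)
    {A : Type v} [CommRing A] [IsLocalRing A] (e : A ≃+* R ⧸ I) {u : R} (huI : u ∈ I)
    (hu2 : u ∉ maximalIdeal R ^ 2) :
    Module.finrank (ResidueField A) (CotangentSpace A) + 1 ≤
      Module.finrank (ResidueField R) (CotangentSpace R) := by
  haveI : IsLocalRing (R ⧸ I) := e.isLocalRing
  haveI : IsNoetherianRing A := isNoetherianRing_of_ringEquiv (R ⧸ I) e.symm
  rw [finrank_cotangentSpace_eq_of_ringEquiv e]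
  exact (exists_mem_not_mem_sq_iff_finrank_cotangentSpace_lt I).mp ⟨u, huI, hu2⟩

end Quotient

/-! ## (ii) The dictionary at a regular local ring of dimension `d + 1` -/

section Regular

variable {R : Type u} [CommRing R]

/-- For a regular local ring of dimension `n`, `μ(𝔪) = n` as natural numbers. [folklore] -/
theorem spanFinrank_maximalIdeal_eq_of_ringKrullDim_eq [IsRegularLocalRing R] {n : ℕ}
    (hdim : ringKrullDim R = n) : (maximalIdeal R).spanFinrank = n := by
  have h := IsRegularLocalRing.spanFinrank_maximalIdeal (R := R)
  rw [hdim] at h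
  exact_mod_cast h

/-- **B2 (ii), ring form.** Let `R` be a regular local ring with `dim R = d + 1` and `I` an ideal with `R ⧸ I`
local (i.e. `I ≤ 𝔪`). Then the
embedding dimension of `R ⧸ I` is at most `d` iff `I` contains an element outside `𝔪²`:
`finrank (𝔪_{R⧸I}/𝔪_{R⧸I}²) ≤ d ↔ ∃ u ∈ I, u ∉ 𝔪²`. (res-D-pv-013's «Adm ⟺ ∃u given 𝒪 regular of dimension
`n + 1` and `𝒪_{Γ,z} = 𝒪/(I_T)`», at the level of the quotient ring.) [folklore] [cite: Matsumura1987, Thm. 14.2] -/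
theorem finrank_cotangentSpace_quotient_le_iff [IsRegularLocalRing R] {d : ℕ} (hdim : ringKrullDim R = (d + 1 : ℕ))
    (I : Ideal R) [IsLocalRing (R ⧸ I)] :
    Module.finrank (ResidueField (R ⧸ I)) (CotangentSpace (R ⧸ I)) ≤ d ↔ ∃ u ∈ I, u ∉ maximalIdeal R ^ 2 := by
  rw [exists_mem_not_mem_sq_iff_spanFinrank_lt I, ← spanFinrank_maximalIdeal_eq_finrank_cotangentSpace,
    spanFinrank_maximalIdeal_eq_of_ringKrullDim_eq hdim]
  omega

/-- **B2 (ii), transported to the stalk.** Let `R` be a regular local ring with `dim R = d + 1`, `I` an ideal,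
and `A` any local ring with `A ≃+* R ⧸ I` (e.g. `A = 𝒪_{Γ,z}`, `R = 𝒪_{X',ι z}`, `I = (I_T)_{ι z}`). Then
`finrank (𝔪_A/𝔪_A²) ≤ d ↔ ∃ u ∈ I, u ∉ 𝔪_R²`. [folklore] -/
theorem finrank_cotangentSpace_le_iff_of_ringEquiv_quotient [IsRegularLocalRing R] {d : ℕ}
    (hdim : ringKrullDim R = (d + 1 : ℕ)) (I : Ideal R)
    {A : Type v} [CommRing A] [IsLocalRing A] (e : A ≃+* R ⧸ I) :
    Module.finrank (ResidueField A) (CotangentSpace A) ≤ d ↔ ∃ u ∈ I, u ∉ maximalIdeal R ^ 2 := by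
  haveI : IsLocalRing (R ⧸ I) := e.isLocalRing
  haveI : IsNoetherianRing A := isNoetherianRing_of_ringEquiv (R ⧸ I) e.symm
  rw [finrank_cotangentSpace_eq_of_ringEquiv e]
  exact finrank_cotangentSpace_quotient_le_iff hdim I

/-- The embedding dimension of a regular local ring of dimension `n` is `n` (cotangent form). [folklore] -/
theorem finrank_cotangentSpace_eq_of_ringKrullDim_eq [IsRegularLocalRing R] {n : ℕ} (hdim : ringKrullDim R = n) :
    Module.finrank (ResidueField R) (CotangentSpace R) = n := by
  rw [← spanFinrank_maximalIdeal_eq_finrank_cotangentSpace]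
  exact spanFinrank_maximalIdeal_eq_of_ringKrullDim_eq hdim

end Regular

end Summit.ResolutionOfSingularities.ResolutionOfSingularities.Cruxes.EquisingularLiftNat.Sections
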